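import Literature.Analysis.Hypoelliptic.EllipticParametrix
import HarnessLib

/-!
# Elliptic regularity by the duality bootstrap: elliptic operators with smooth coefficients are hypoelliptic

Analysis/Hypoelliptic: the proof of the named fact
`Literature.Analysis.Distribution.Folland1995_cor634` (G. B. Folland, *Introduction to Partial
Differential Equations*, 2nd ed. (1995), Corollary (6.34): "Every elliptic operator with `C^∞`
coefficients is hypoelliptic"), assembled on the Fourier-side toolkit of the proof of
Hörmander's theorem (`FiniteOrderK`, `RieszSchwartz`, `ShadowLin`, `Smoothness`,
`SmoothLocality`, `Transport`) and the amplitude calculus of `Amplitude.lean`,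
`AmplitudeOperator.lean`, `EllipticParametrix.lean`.

**The argument** (a duality form of Folland's bootstrap (6.32)–(6.33), with the crude
parametrix of `EllipticParametrix.lean` in place of the a priori estimate (6.29)). Transport the
data to the Euclidean model space `V` (`T : E ≃L V`). For a cutoff `ζ` let `G_ζ ∈ Ĥ^{-M}` be the
Fourier side of `ζ u` (`exists_fourierSide_unif`). If `ζ' = 1` near the support of a cutoff `χ`
on `V` which is `1` on `T(tsupport ζ)`, and `G_{ζ'} ∈ Ĥ^m`, then `G_ζ ∈ Ĥ^{m+1}`
(`elliptic_bootstrap_step`): for a Schwartz `ψ`, with `h = conj 𝓕ψ`, `g = (ζ ∘ T⁻¹) h`, `F = 𝓕g`, the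
parametrix identity gives `g = ᵗL^V w - ρ`, `w = Op(q)F`, `ρ = Op(r)F`, so
`⟨G_ζ, ψ⟩ = u(ζ · h∘T) = ∫ f (w∘T) dμ - ⟨G_{ζ'}, ψ_ρ⟩` by the hypothesis `Lu = f` on `U`, and
both terms are `O(‖ψ‖_{-m-1})` by the Sobolev bounds of amplitude operators (`q` of order `-k`,
`r` of order `-1`); Riesz representation (`exists_inH_pairing_eq`) and uniqueness
(`ae_eq_of_forall_pairing_schwartz`) upgrade `G_ζ`. Iterating along nested balls from the uniform
finite-order start, `G_ζ ∈ ⋂_t Ĥ^t`, and `Rep.isSmoothOn` + `IsSmoothOn.of_locally` give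
`u ∈ C^∞(U)` (`isHypoellipticOn_of_isEllipticOn`).

## References

* G. B. Folland, *Introduction to Partial Differential Equations*, 2nd ed. (1995), Thm (6.33),
  Cor. (6.34).
* M. E. Taylor, *Pseudodifferential Operators* (1981), Ch. III §1 (elliptic regularity via
  parametrices; folklore).
-/

noncomputable section

open MeasureTheory Set Filter Function TopologicalSpace Real Metric SchwartzMap Distributions TestFunction
open scoped Topology InnerProductSpace BigOperators ContDiff ComplexConjugate FourierTransform ENNReal

namespace Literature.Analysis.Hypoelliptic

open Literature.Analysis.Distribution

variable {E : Type*} [NormedAddCommGroup E] [NormedSpace ℝ E]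
variable {V : Type*} [NormedAddCommGroup V] [InnerProductSpace ℝ V]
variable {ι : Type*} {X : ι → E → E} {S : Finset (List ι)} {a : List ι → E → ℝ} {k : ℕ}

/-! ### Transport of the transposed operator to the model space -/

/-- The transported coefficients `b_w = a_w ∘ T⁻¹`. [folklore] -/
def pushCoef (T : E ≃L[ℝ] V) (a : List ι → E → ℝ) : List ι → V → ℝ := fun w y => a w (T.symm y)

/-- (structural lemma) [folklore] -/
@[simp] theorem pushCoef_apply (T : E ≃L[ℝ] V) (a : List ι → E → ℝ) (w : List ι) (y : V) :
    pushCoef T a w y = a w (T.symm y) := rfl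

/-- **`ᵗX_w (G ∘ T) = (ᵗ(T_*X)_w G) ∘ T`.** [folklore] -/
theorem wordTranspose_comp [FiniteDimensional ℝ E] [FiniteDimensional ℝ V] (T : E ≃L[ℝ] V)
    (hX : ∀ i, ContDiff ℝ ∞ (X i)) : ∀ (w : List ι) {G : V → ℝ}, ContDiff ℝ ∞ G →
      wordTranspose X w (fun x => G (T x)) = fun x => wordTranspose (fun i => push T (X i)) w G (T x)
  | [], _, _ => rfl
  | i :: w, G, hG => by
    rw [wordTranspose_cons]
    have e : fieldTranspose (X i) (fun x => G (T x)) = fun x => fieldTranspose (push T (X i)) G (T x) :=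
      funext fun x => fieldTranspose_comp T ((hX i).differentiable (by simp)) (hG.differentiable (by simp)) x
    rw [e]
    exact wordTranspose_comp T hX w (contDiff_fieldTranspose (contDiff_push T (hX i)) hG)

/-- **`ᵗL (G ∘ T) = (ᵗL^V G) ∘ T`** for the transported data `(T_*X, a ∘ T⁻¹)`. [folklore] -/
theorem smoothDiffOpTranspose_comp [FiniteDimensional ℝ E] [FiniteDimensional ℝ V] (T : E ≃L[ℝ] V)
    (hX : ∀ i, ContDiff ℝ ∞ (X i)) (ha : ∀ w, ContDiff ℝ ∞ (a w)) (S : Finset (List ι)) {G : V → ℝ}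
    (hG : ContDiff ℝ ∞ G) (x : E) :
    smoothDiffOpTranspose X S a (fun x => G (T x)) x =
      smoothDiffOpTranspose (fun i => push T (X i)) S (pushCoef T a) G (T x) := by
  simp only [smoothDiffOpTranspose]
  refine Finset.sum_congr rfl fun w _ => ?_
  have e : (fun y => a w y * G (T y)) = fun y => (fun z => pushCoef T a w z * G z) (T y) := by
    ext y; simp [pushCoef]
  rw [e, wordTranspose_comp T hX w (G := fun z => pushCoef T a w z * G z)
    (by exact ((ha w).comp T.symm.contDiff).mul hG)]

/-! ### The twisted symbol of the transported data and ellipticity -/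

/-- The principal symbol of the transported data. [folklore] -/
theorem principalSymbol_push (T : E ≃L[ℝ] V) (x : E) (ℓ : V →L[ℝ] ℝ) :
    principalSymbol (fun i => push T (X i)) S (pushCoef T a) k (T x) ℓ =
      principalSymbol X S a k x (ℓ.comp (T : E →L[ℝ] V)) := by
  simp only [principalSymbol, pushCoef_apply, push_apply, ContinuousLinearEquiv.symm_apply_apply,
    ContinuousLinearMap.comp_apply, ContinuousLinearEquiv.coe_coe]

/-- `Λ_w = (-2πi)^{|w|} ∏_{i ∈ w} ⟨ξ, X_i x⟩`. [folklore] -/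
theorem Lam_eq_pow_mul (Y : ι → V → V) (x ξ : V) : ∀ w : List ι,
    Lam Y w x ξ = (-(2 * π * Complex.I)) ^ w.length * (w.map fun i => ((⟪ξ, Y i x⟫_ℝ : ℝ) : ℂ)).prod
  | [] => by simp
  | i :: w => by
    rw [Lam_cons, Lam_eq_pow_mul Y x ξ w, List.map_cons, List.prod_cons, List.length_cons, pow_succ]
    simp only [lam]; ring

/-- Casting a list product of reals to `ℂ`. [folklore] -/
theorem ofReal_list_prod_map {κ : Type*} (g : κ → ℝ) : ∀ l : List κ,
    (((l.map g).prod : ℝ) : ℂ) = (l.map fun i => (g i : ℂ)).prod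
  | [] => by simp
  | i :: l => by rw [List.map_cons, List.prod_cons, List.map_cons, List.prod_cons, Complex.ofReal_mul, ofReal_list_prod_map g l]

/-- **`σ̃ = (-2πi)^k σ_k`**: the twisted symbol is `(-2πi)^k` times the principal symbol (at the
covector `⟨ξ, ·⟩`). [folklore] -/
theorem twSymb_eq_principalSymbol (Y : ι → V → V) (S : Finset (List ι)) (b : List ι → V → ℝ) (k : ℕ) (x ξ : V) :
    twSymb Y S b k x ξ = (-(2 * π * Complex.I)) ^ k * (principalSymbol Y S b k x (innerSL ℝ ξ) : ℂ) := by
  simp only [twSymb, principalSymbol, Complex.ofReal_sum, Complex.ofReal_mul, ofReal_list_prod_map, Finset.mul_sum]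
  refine Finset.sum_congr rfl fun w hw => ?_
  rw [Lam_eq_pow_mul, (Finset.mem_filter.1 hw).2]
  simp only [innerSL_apply_apply]
  ring

/-- **Ellipticity transports**: if `(X, S, a)` is elliptic of order `k` on `Ω` then the twisted
symbol of the transported data does not vanish at `(T x, ξ)`, `x ∈ Ω`, `ξ ≠ 0`. [folklore] -/
theorem twSymb_ne_zero_of_isEllipticOn {Ω : Set E} (hell : IsEllipticOn X S a k Ω) (T : E ≃L[ℝ] V) {x : E}
    (hx : x ∈ Ω) {ξ : V} (hξ : ξ ≠ 0) :
    twSymb (fun i => push T (X i)) S (pushCoef T a) k (T x) ξ ≠ 0 := by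
  rw [twSymb_eq_principalSymbol, principalSymbol_push]
  refine mul_ne_zero (pow_ne_zero _ (neg_ne_zero.2 ?_)) ?_
  · simp [Real.pi_ne_zero, Complex.I_ne_zero]
  · rw [Ne, Complex.ofReal_eq_zero]
    refine hell.2 x hx _ fun h => hξ ?_
    have h1 := congrArg (fun L : E →L[ℝ] ℝ => L (T.symm ξ)) h
    simp only [ContinuousLinearMap.comp_apply, ContinuousLinearEquiv.coe_coe, ContinuousLinearEquiv.apply_symm_apply,
      innerSL_apply_apply, zero_apply] at h1
    exact inner_self_eq_zero.1 h1

/-! ### Conjugation and the Fourier transform; conjugate data -/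

section Conj

variable [FiniteDimensional ℝ V] [MeasurableSpace V] [BorelSpace V]

/-- `𝓕⁻¹ (conj f) = conj (𝓕 f)`. [folklore] -/
theorem fourierInv_conj (f : V → ℂ) : 𝓕⁻ (fun v => conj (f v)) = fun x => conj (𝓕 f x) := by
  ext x
  rw [Real.fourierInv_eq', Real.fourier_eq', ← integral_conj]
  refine integral_congr_ae (Eventually.of_forall fun v => ?_)
  simp only [smul_eq_mul, map_mul, ← Complex.exp_conj, Complex.conj_ofReal, Complex.conj_I]
  congr 1; push_cast; ring

/-- `InH` is conjugation invariant. [folklore] -/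
theorem InH.conj {t : ℝ} {F : V → ℂ} (hF : InH t F) : InH t (fun ξ => conj (F ξ)) :=
  ⟨Complex.continuous_conj.comp_aestronglyMeasurable hF.1, by rw [wnorm_conj]; exact hF.2⟩

/-- `Nice` is conjugation invariant. [folklore] -/
theorem Nice.conj {F : V → ℂ} (hF : Nice F) : Nice (fun ξ => conj (F ξ)) :=
  ⟨Complex.continuous_conj.comp_aestronglyMeasurable hF.1, fun t => by rw [wnorm_conj]; exact hF.2 t⟩

end Conj

/-! ### The hypothesis `L u = f` on `U`, in complexified transported form -/

section Hyp

variable [FiniteDimensional ℝ E] [MeasurableSpace E] [BorelSpace E] [FiniteDimensional ℝ V] {Ω : Opens E}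

omit [FiniteDimensional ℝ E] [MeasurableSpace E] [BorelSpace E] [FiniteDimensional ℝ V] in
/-- The support of `w ∘ T` is the preimage of the support of `w`. [folklore] -/
theorem tsupport_comp_subset_preimage (T : E ≃L[ℝ] V) (w : V → ℂ) :
    tsupport (fun x => w (T x)) ⊆ (T : E → V) ⁻¹' tsupport w :=
  closure_minimal (fun x hx => subset_closure (by simpa using hx)) ((isClosed_tsupport w).preimage T.continuous)

/-- **`uC u ζ' (ᵗL^V w ∘ T) = ∫ f (w ∘ T) dμ`** for a smooth complex `w` supported in a compact
`K_V` with `T⁻¹(K_V) ⊆ U ∩ Ω`, when `L u = f` on `U` (the hypothesis `ImageIsSmoothOn`, tested on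
the real and imaginary parts of `w ∘ T`) and `ζ' = 1` on `T⁻¹(K_V)`. [folklore] -/
theorem uC_opC_comp_eq_integral (μ : Measure E) [IsLocallyFiniteMeasure μ] (T : E ≃L[ℝ] V)
    (hX : ∀ i, ContDiff ℝ ∞ (X i)) (ha : ∀ w, ContDiff ℝ ∞ (a w))
    {u : 𝓓'(Ω, ℝ)} {U : Set E} (hU : IsOpen U) {f : E → ℝ} (hfU : ContinuousOn f U)
    (hfu : ∀ φ ψ : 𝓓(Ω, ℝ), tsupport (φ : E → ℝ) ⊆ U → (ψ : E → ℝ) = smoothDiffOpTranspose X S a φ →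
      u ψ = ∫ x, f x * φ x ∂μ)
    {Kv : Set V} (hKv : IsCompact Kv) (hKU : (T : E → V) ⁻¹' Kv ⊆ U) (hKΩ : (T : E → V) ⁻¹' Kv ⊆ Ω)
    {ζ' : 𝓓(Ω, ℝ)} (hζ' : ∀ x ∈ (T : E → V) ⁻¹' Kv, ζ' x = 1)
    {w : V → ℂ} (hw : ContDiff ℝ ∞ w) (hws : tsupport w ⊆ Kv) :
    uC u ζ' (fun x => opC (fun i => push T (X i)) S (pushCoef T a) w (T x)) = ∫ x, (f x : ℂ) * w (T x) ∂μ := by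
  set Y : ι → V → V := fun i => push T (X i) with hY
  set b : List ι → V → ℝ := pushCoef T a with hb
  have hYs : ∀ i, ContDiff ℝ ∞ (Y i) := fun i => contDiff_push T (hX i)
  have hbs : ∀ w', ContDiff ℝ ∞ (b w') := fun w' => (ha w').comp T.symm.contDiff
  have haS : ∀ w' ∈ S, ContDiff ℝ ∞ (a w') := fun w' _ => ha w'
  -- the real and imaginary parts of `w ∘ T` as test functions supported in `T⁻¹ K_V`
  have hwT : ContDiff ℝ ∞ fun x => w (T x) := hw.comp T.contDiff
  have hKE : IsCompact ((T : E → V) ⁻¹' Kv) := by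
    rw [← T.image_symm_eq_preimage]; exact hKv.image T.symm.continuous
  have hsupp : tsupport (fun x => w (T x)) ⊆ (T : E → V) ⁻¹' Kv :=
    (tsupport_comp_subset_preimage T w).trans (preimage_mono hws)
  have hcs : HasCompactSupport fun x => w (T x) := IsCompact.of_isClosed_subset hKE (isClosed_tsupport _) hsupp
  have hre_s : ContDiff ℝ ∞ fun x => (w (T x)).re := Complex.reCLM.contDiff.comp hwT
  have him_s : ContDiff ℝ ∞ fun x => (w (T x)).im := Complex.imCLM.contDiff.comp hwT
  have hre_supp : tsupport (fun x => (w (T x)).re) ⊆ (T : E → V) ⁻¹' Kv :=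
    (closure_mono fun x hx => by rw [mem_support] at hx ⊢; intro h0; exact hx (by simp [h0])).trans hsupp
  have him_supp : tsupport (fun x => (w (T x)).im) ⊆ (T : E → V) ⁻¹' Kv :=
    (closure_mono fun x hx => by rw [mem_support] at hx ⊢; intro h0; exact hx (by simp [h0])).trans hsupp
  let φr : 𝓓(Ω, ℝ) := ⟨fun x => (w (T x)).re, hre_s, hcs.comp_left Complex.zero_re, hre_supp.trans hKΩ⟩
  let φi : 𝓓(Ω, ℝ) := ⟨fun x => (w (T x)).im, him_s, hcs.comp_left Complex.zero_im, him_supp.trans hKΩ⟩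
  -- the complexified operator in terms of the real one
  have hop : ContDiff ℝ ∞ fun x => opC Y S b w (T x) := (contDiff_opC hYs hbs hw).comp T.contDiff
  have hre : (fun x => (opC Y S b w (T x)).re) = smoothDiffOpTranspose X S a φr := by
    ext x
    rw [opC_re hYs S hbs hw]
    exact (smoothDiffOpTranspose_comp T hX ha S (Complex.reCLM.contDiff.comp hw) x).symm
  have him : (fun x => (opC Y S b w (T x)).im) = smoothDiffOpTranspose X S a φi := by
    ext x
    rw [opC_im hYs S hbs hw]
    exact (smoothDiffOpTranspose_comp T hX ha S (Complex.imCLM.contDiff.comp hw) x).symm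
  -- each real piece
  have hpiece : ∀ φ : 𝓓(Ω, ℝ), tsupport (φ : E → ℝ) ⊆ (T : E → V) ⁻¹' Kv →
      ∀ hs : ContDiff ℝ ∞ (smoothDiffOpTranspose X S a φ),
      (u (mulSmooth ζ' (smoothDiffOpTranspose X S a φ) hs) : ℂ) = ((∫ x, f x * φ x ∂μ : ℝ) : ℂ) := by
    intro φ hφ hs
    have emul : mulSmooth ζ' (smoothDiffOpTranspose X S a φ) hs = smoothDiffOpTransposeTestFunction hX haS φ := by
      ext x
      rw [mulSmooth_apply, coe_smoothDiffOpTransposeTestFunction]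
      by_cases hx : x ∈ tsupport (smoothDiffOpTranspose X S a φ)
      · rw [hζ' x (hφ (tsupport_smoothDiffOpTranspose_subset S a φ hx)), one_mul]
      · rw [image_eq_zero_of_notMem_tsupport hx, mul_zero]
    rw [emul, hfu φ _ (hφ.trans hKU) (coe_smoothDiffOpTransposeTestFunction hX haS φ)]
  rw [uC_eq u ζ' hop]
  have e1 : mulSmooth ζ' (fun x => (opC Y S b w (T x)).re) (Complex.reCLM.contDiff.comp hop) =
      mulSmooth ζ' (smoothDiffOpTranspose X S a φr) (contDiff_smoothDiffOpTranspose hX haS φr.contDiff) :=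
    mulSmooth_congr ζ' _ _ hre
  have e2 : mulSmooth ζ' (fun x => (opC Y S b w (T x)).im) (Complex.imCLM.contDiff.comp hop) =
      mulSmooth ζ' (smoothDiffOpTranspose X S a φi) (contDiff_smoothDiffOpTranspose hX haS φi.contDiff) :=
    mulSmooth_congr ζ' _ _ him
  rw [e1, e2, hpiece φr hre_supp, hpiece φi him_supp]
  -- reassemble the integral
  have hfr : Integrable (fun x => f x * φr x) μ :=
    integrable_mul_of_tsupport_subset hU hfU φr.contDiff.continuous φr.hasCompactSupport (hre_supp.trans hKU)
  have hfi : Integrable (fun x => f x * φi x) μ :=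
    integrable_mul_of_tsupport_subset hU hfU φi.contDiff.continuous φi.hasCompactSupport (him_supp.trans hKU)
  have e3 : (fun x => (f x : ℂ) * w (T x)) = fun x => ((f x * φr x : ℝ) : ℂ) + Complex.I * ((f x * φi x : ℝ) : ℂ) := by
    ext x
    have hw' : w (T x) = ((w (T x)).re : ℂ) + ((w (T x)).im : ℂ) * Complex.I := (Complex.re_add_im _).symm
    show (f x : ℂ) * w (T x) = ((f x * (w (T x)).re : ℝ) : ℂ) + Complex.I * ((f x * (w (T x)).im : ℝ) : ℂ)
    conv_lhs => rw [hw']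
    push_cast; ring
  rw [e3, integral_add hfr.ofReal (hfi.ofReal.const_mul _), integral_const_mul,
    show (∫ x, ((f x * φr x : ℝ) : ℂ) ∂μ) = ((∫ x, f x * φr x ∂μ : ℝ) : ℂ) from integral_ofReal,
    show (∫ x, ((f x * φi x : ℝ) : ℂ) ∂μ) = ((∫ x, f x * φi x ∂μ : ℝ) : ℂ) from integral_ofReal]

end Hyp

/-! ### The bootstrap step: one derivative gained -/

section Step

variable [FiniteDimensional ℝ E] [MeasurableSpace E] [BorelSpace E]
variable [FiniteDimensional ℝ V] [MeasurableSpace V] [BorelSpace V] {Ω : Opens E}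

/-- From an `ℝ≥0∞` operator bound to the real-norm bound. [folklore] -/
theorem rn_le_of_wnorm_le {s₁ s₂ C : ℝ} {A₁ A₂ : V → ℂ} (hC : 0 ≤ C)
    (h : wnorm s₁ A₁ ≤ ENNReal.ofReal C * wnorm s₂ A₂) (hfin : wnorm s₂ A₂ < ⊤) :
    rn s₁ A₁ ≤ C * rn s₂ A₂ := by
  unfold rn
  have hne : ENNReal.ofReal C * wnorm s₂ A₂ ≠ ⊤ := ENNReal.mul_ne_top ENNReal.ofReal_ne_top hfin.ne
  calc (wnorm s₁ A₁).toReal ≤ (ENNReal.ofReal C * wnorm s₂ A₂).toReal := ENNReal.toReal_mono hne h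
    _ = C * (wnorm s₂ A₂).toReal := by rw [ENNReal.toReal_mul, ENNReal.toReal_ofReal hC]

/-- `∫ A · 𝓕w` is a pairing, hence bounded by dual weighted norms. [folklore] -/
theorem norm_integral_mul_fourier_le {j : ℝ} {A : V → ℂ} (hA : InH j A) (w : 𝓢(V, ℂ)) :
    ‖∫ y, A y * 𝓕 (w : V → ℂ) y‖ ≤ rn j A * rn (-j) (𝓕 (w : V → ℂ)) := by
  have e : (∫ y, A y * 𝓕 (w : V → ℂ) y) = pairing A (fun y => conj (𝓕 (w : V → ℂ) y)) := by
    unfold pairing; simp only [Complex.conj_conj]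
  rw [e]
  have hW : InH (-j) (fun y => conj (𝓕 (w : V → ℂ) y)) := by
    have h := ((SchwartzMap.nice (𝓕 w)).inH (-j)).conj
    rwa [SchwartzMap.fourier_coe] at h
  refine (norm_pairing_le hA hW).trans (le_of_eq ?_)
  unfold rn; rw [wnorm_conj]

/-- **The bootstrap step.** Notation as in the module docstring: if `L u = f` on `U ⊇ T⁻¹(tsupport χ)`
(hypothesis `hfu`), `χ = 1` on `T(tsupport ζ)`, `ζ' = 1` on `T⁻¹(tsupport χ)` and on `tsupport ζ`,
`G` is the Fourier side of `ζ u` (in some `Ĥ^t`) and the Fourier side `G'` of `ζ' u` lies in `Ĥ^m`,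
then `G ∈ Ĥ^{m+1}`. [folklore] -/
theorem elliptic_bootstrap_step [Nontrivial V] (μ : Measure E) [IsLocallyFiniteMeasure μ] (T : E ≃L[ℝ] V)
    {cT : ℝ} (hT : ∀ g : V → ℂ, ∫ x, g (T x) ∂μ = (cT : ℂ) * ∫ y, g y)
    (hX : ∀ i, ContDiff ℝ ∞ (X i)) (ha : ∀ w, ContDiff ℝ ∞ (a w)) (hS : ∀ w ∈ S, w.length ≤ k)
    {u : 𝓓'(Ω, ℝ)} {U : Set E} (hU : IsOpen U) {f : E → ℝ} (hfU : ContDiffOn ℝ ∞ f U)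
    (hfu : ∀ φ ψ : 𝓓(Ω, ℝ), tsupport (φ : E → ℝ) ⊆ U → (ψ : E → ℝ) = smoothDiffOpTranspose X S a φ →
      u ψ = ∫ x, f x * φ x ∂μ)
    {χ : V → ℝ} (hχ : ContDiff ℝ ∞ χ) (hχc : HasCompactSupport χ)
    (hχU : (T : E → V) ⁻¹' tsupport χ ⊆ U) (hχΩ : (T : E → V) ⁻¹' tsupport χ ⊆ Ω)
    (hell : ∀ y ∈ tsupport χ, ∀ ξ : V, ξ ≠ 0 → twSymb (fun i => push T (X i)) S (pushCoef T a) k y ξ ≠ 0)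
    {ζ ζ' : 𝓓(Ω, ℝ)} (hζχ : ∀ x ∈ tsupport (ζ : E → ℝ), χ (T x) = 1)
    (hζ'χ : ∀ x ∈ (T : E → V) ⁻¹' tsupport χ, ζ' x = 1) (hζζ' : ∀ x ∈ tsupport (ζ : E → ℝ), ζ' x = 1)
    {G G' : V → ℂ} (hG : ∀ ψ : 𝓢(V, ℂ), pairing G ψ = fourierFun u ζ (T : E →L[ℝ] V) ψ)
    (hGt : ∃ t, InH t G) (hG' : Rep u ζ' (T : E →L[ℝ] V) G' id) {m : ℝ} (hG'm : InH m G') :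
    InH (m + 1) G := by
  set Y : ι → V → V := fun i => push T (X i) with hY
  set b : List ι → V → ℝ := pushCoef T a with hb
  have hYs : ∀ i, ContDiff ℝ ∞ (Y i) := fun i => contDiff_push T (hX i)
  have hbs : ∀ w', ContDiff ℝ ∞ (b w') := fun w' => (ha w').comp T.symm.contDiff
  -- the parametrix and the Sobolev constants
  obtain ⟨q, r, hq, hr, hqs, hqr⟩ := exists_parametrix hYs hbs hS hχ hχc hell
  obtain ⟨Cq, hCq0, hCq⟩ := hq.exists_wnorm_fourier_ampOp_le (-m - 1)
  obtain ⟨Cr, hCr0, hCr⟩ := hr.exists_wnorm_fourier_ampOp_le (-m - 1)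
  -- the cutoff `ζ` on the model space, an amplitude of order `0`
  set ζV : V → ℝ := fun y => ζ (T.symm y) with hζV
  have hζVs : ContDiff ℝ ∞ ζV := ζ.contDiff.comp T.symm.contDiff
  have hζVc : HasCompactSupport ζV := ζ.hasCompactSupport.comp_homeomorph T.symm.toHomeomorph
  have h0 : IsAmp (fun x (_ : V) => (ζV x : ℂ)) 0 := IsAmp.of_fun_real hζVs hζVc
  obtain ⟨C0, hC00, hC0⟩ := h0.exists_wnorm_fourier_ampOp_le (-m - 1)
  -- the cutoff `χ₁` on `E` and the Schwartz avatar of `χ₁ f`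
  have hKE : IsCompact ((T : E → V) ⁻¹' tsupport χ) := by
    rw [← T.image_symm_eq_preimage]; exact hχc.image T.symm.continuous
  obtain ⟨χ₁, hχ₁s, hχ₁c, hχ₁supp, hχ₁1⟩ := exists_bump hKE hU hχU
  have hF₁s : ContDiff ℝ ∞ fun x => χ₁ x * f x :=
    contDiff_cutoff_mul' hχ₁s hχ₁supp fun y hy => hfU.contDiffAt (hU.mem_nhds hy)
  have hF₁c : HasCompactSupport fun x => χ₁ x * f x := hχ₁c.mul_right
  obtain ⟨qF, hqF, -⟩ := exists_avatar_real T hF₁s hF₁c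
  set A : 𝓢(V, ℂ) := 𝓕⁻ qF with hA
  set j : ℝ := m + 1 - k with hj
  have hAj : InH j (A : V → ℂ) := (SchwartzMap.nice A).inH j
  have hFA : ∀ y, 𝓕 (A : V → ℂ) y = qF y := fun y => by
    rw [← SchwartzMap.fourier_coe, hA, FourierTransform.fourier_fourierInv_eq]
  -- the constant
  set Ctot : ℝ := ‖(cT : ℂ)‖ * rn j (A : V → ℂ) * Cq * C0 + rn m G' * Cr * C0 with hCtot
  -- the bound of the functional
  have hbound : ∀ ψ : 𝓢(V, ℂ), ‖fourierFun u ζ (T : E →L[ℝ] V) ψ‖ ≤ Ctot * rn (-m - 1) (ψ : V → ℂ) := by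
    intro ψ
    -- the data `F₀ = conj ψ`, `h = conj 𝓕ψ = 𝓕⁻¹ F₀`
    set F₀ : V → ℂ := fun ξ => conj (ψ ξ) with hF₀
    have hF₀n : Nice F₀ := (SchwartzMap.nice ψ).conj
    set h : V → ℂ := fun y => conj (𝓕 ψ y) with hh
    have hhs : ContDiff ℝ ∞ h := Complex.conjCLE.contDiff.comp ((𝓕 ψ).smooth ⊤)
    have hinvF₀ : 𝓕⁻ F₀ = h := by
      rw [hF₀, fourierInv_conj]; ext y; rw [hh, ← SchwartzMap.fourier_coe]
    -- `g = ζV · h` as an amplitude operator, `F = 𝓕 g`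
    set g : V → ℂ := ampOp (fun x (_ : V) => (ζV x : ℂ)) F₀ with hg
    have hg_eq : g = fun y => (ζV y : ℂ) * h y := by rw [hg, ampOp_of_fun, hinvF₀]
    have hgs : ContDiff ℝ ∞ g := h0.contDiff_ampOp hF₀n
    set F : V → ℂ := 𝓕 g with hFdef
    have hF : Nice F := h0.nice_fourier_ampOp hF₀n
    have hinvF : 𝓕⁻ F = g :=
      hgs.continuous.fourierInv_fourier_eq (h0.integrable_ampOp_fun hF₀n) (integrable_of_nice hF)
    -- `w = Op(q) F`, `ρ = Op(r) F`, and the parametrix identity `g = ᵗL w - ρ`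
    set w : V → ℂ := ampOp q F with hwdef
    set ρ : V → ℂ := ampOp r F with hρdef
    have hws : ContDiff ℝ ∞ w := hq.contDiff_ampOp hF
    have hρs : ContDiff ℝ ∞ ρ := hr.contDiff_ampOp hF
    have hwsupp : tsupport w ⊆ tsupport χ := tsupport_ampOp_subset hqs (isClosed_tsupport χ) F
    have hχg : ∀ y, (χ y : ℂ) * g y = g y := by
      intro y
      by_cases hgy : g y = 0
      · rw [hgy, mul_zero]
      · have hζy : ζ (T.symm y) ≠ 0 := by
          intro h0'; apply hgy; rw [hg_eq]; simp [hζV, h0']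
        have hy : T.symm y ∈ tsupport (ζ : E → ℝ) := subset_tsupport _ (mem_support.2 hζy)
        have := hζχ (T.symm y) hy
        rw [ContinuousLinearEquiv.apply_symm_apply] at this
        rw [this]; simp
    have hdec : ∀ y, g y = opC Y S b w y - ρ y := by
      intro y
      have h1 := hq.opC_ampOp hYs S hbs hF
      rw [hqr, (IsAmp.of_fun_real hχ hχc).ampOp_add hr hF, ampOp_of_fun, hinvF] at h1
      have h2 := congrFun h1 y
      simp only at h2
      rw [hχg y] at h2
      rw [← hwdef] at h2
      rw [h2, hρdef]; ring
    -- `⟨G, ψ⟩ = u(ζ h∘T) = uC u ζ' (g ∘ T)`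
    have hstep1 : fourierFun u ζ (T : E →L[ℝ] V) ψ = uC u ζ' (fun x => g (T x)) := by
      rw [fourierFun_eq_uC]
      have hprod : ∀ x, ζ' x * ζ x = ζ x := fun x => by
        by_cases hx : x ∈ tsupport (ζ : E → ℝ)
        · rw [hζζ' x hx, one_mul]
        · rw [image_eq_zero_of_notMem_tsupport hx, mul_zero]
      rw [uC_cutoff u hprod (contDiff_conj_fourier_comp (T : E →L[ℝ] V) ψ)]
      refine uC_congr u ζ' (funext fun x => ?_)
      rw [hg_eq]
      simp [mulC, hζV, hh]
    -- `uC u ζ' (g ∘ T) = ∫ f (w ∘ T) - uC u ζ' (ρ ∘ T)`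
    have hopT : ContDiff ℝ ∞ fun x => opC Y S b w (T x) := (contDiff_opC hYs hbs hws).comp T.contDiff
    have hρT : ContDiff ℝ ∞ fun x => ρ (T x) := hρs.comp T.contDiff
    have hstep2 : uC u ζ' (fun x => g (T x)) =
        uC u ζ' (fun x => opC Y S b w (T x)) - uC u ζ' (fun x => ρ (T x)) := by
      have e : (fun x => g (T x)) = fun x => opC Y S b w (T x) + -ρ (T x) := by
        ext x; rw [hdec]; ring
      rw [e, uC_add u ζ' hopT hρT.neg, uC_neg u ζ' hρT]; ring
    have hA_term : uC u ζ' (fun x => opC Y S b w (T x)) = (cT : ℂ) * ∫ y, qF y * w y := by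
      rw [uC_opC_comp_eq_integral μ T hX ha hU hfU.continuousOn hfu hχc hχU hχΩ hζ'χ hws hwsupp]
      have e : (fun x => (f x : ℂ) * w (T x)) = fun x => (fun y => qF y * w y) (T x) := by
        ext x
        simp only
        rw [← hqF x]
        by_cases hwx : w (T x) = 0
        · rw [hwx, mul_zero, mul_zero]
        · have hx : x ∈ (T : E → V) ⁻¹' tsupport χ := hwsupp (subset_tsupport _ (mem_support.2 hwx))
          rw [hχ₁1 x hx]; push_cast; ring
      rw [e]; exact hT (fun y => qF y * w y)
    -- the Schwartz avatar of `w` and the bound of the first term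
    obtain ⟨ws, hwsa⟩ := exists_avatarV hws (hq.hasCompactSupport_ampOp F)
    have hwfun : w = (ws : V → ℂ) := funext hwsa
    have hA_bound : ‖uC u ζ' (fun x => opC Y S b w (T x))‖ ≤
        ‖(cT : ℂ)‖ * rn j (A : V → ℂ) * Cq * C0 * rn (-m - 1) (ψ : V → ℂ) := by
      rw [hA_term, norm_mul]
      have e : (∫ y, qF y * w y) = ∫ y, (A : V → ℂ) y * 𝓕 (ws : V → ℂ) y := by
        rw [hwfun, ← SchwartzMap.fourier_coe, ← SchwartzMap.integral_fourier_mul_eq A ws]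
        refine integral_congr_ae (Eventually.of_forall fun y => ?_)
        have hFA' : ((𝓕 A : 𝓢(V, ℂ)) : V → ℂ) y = qF y := by rw [SchwartzMap.fourier_coe]; exact hFA y
        beta_reduce; rw [hFA']
      rw [e]
      have h1 := norm_integral_mul_fourier_le hAj ws
      have h2 : rn (-j) (𝓕 (ws : V → ℂ)) ≤ Cq * rn (-m - 1) F := by
        have h := hCq F hF
        rw [← hwdef, hwfun] at h
        have e' : -m - 1 - -(k : ℝ) = -j := by rw [hj]; ring
        rw [e'] at h
        exact rn_le_of_wnorm_le hCq0 h (hF.2 _)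
      have h3 : rn (-m - 1) F ≤ C0 * rn (-m - 1) (ψ : V → ℂ) := by
        have h := hC0 F₀ hF₀n
        rw [sub_zero] at h
        have h' := rn_le_of_wnorm_le hC00 h (hF₀n.2 _)
        have e' : rn (-m - 1) F₀ = rn (-m - 1) (ψ : V → ℂ) := by unfold rn; rw [hF₀, wnorm_conj]
        rwa [e'] at h'
      have := rn_nonneg j (A : V → ℂ)
      have := rn_nonneg (-m - 1) F
      calc ‖(cT : ℂ)‖ * ‖∫ y, (A : V → ℂ) y * 𝓕 (ws : V → ℂ) y‖
          ≤ ‖(cT : ℂ)‖ * (rn j (A : V → ℂ) * (Cq * (C0 * rn (-m - 1) (ψ : V → ℂ)))) := by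
            refine mul_le_mul_of_nonneg_left (h1.trans ?_) (norm_nonneg _)
            exact mul_le_mul_of_nonneg_left (h2.trans (mul_le_mul_of_nonneg_left h3 hCq0)) (rn_nonneg _ _)
        _ = _ := by ring
    -- the Schwartz function `ψ_ρ` and the bound of the second term
    have hρc : HasCompactSupport ρ := hr.hasCompactSupport_ampOp F
    obtain ⟨qρ, hqρ⟩ := exists_avatarV (f := fun y => conj (ρ y)) (Complex.conjCLE.contDiff.comp hρs)
      (hρc.comp_left (by simp))
    set ψρ : 𝓢(V, ℂ) := 𝓕⁻ qρ with hψρ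
    have hB_term : uC u ζ' (fun x => ρ (T x)) = pairing G' ψρ := by
      rw [hG'.eq ψρ]
      simp only [id]
      congr 1
      ext x
      rw [hψρ, FourierTransform.fourier_fourierInv_eq, ContinuousLinearEquiv.coe_coe, ← hqρ, Complex.conj_conj]
    have hB_bound : ‖uC u ζ' (fun x => ρ (T x))‖ ≤ rn m G' * Cr * C0 * rn (-m - 1) (ψ : V → ℂ) := by
      rw [hB_term]
      have h1 := norm_pairing_le hG'm ((SchwartzMap.nice ψρ).inH (-m))
      have hψρf : (ψρ : V → ℂ) = fun y => conj (𝓕 ρ y) := by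
        rw [hψρ, SchwartzMap.fourierInv_coe, show ((qρ : 𝓢(V, ℂ)) : V → ℂ) = fun y => conj (ρ y) from
          (funext hqρ).symm, fourierInv_conj]
      have h2 : rn (-m) (ψρ : V → ℂ) ≤ Cr * rn (-m - 1) F := by
        have h := hCr F hF
        have e' : -m - 1 - (-1 : ℝ) = -m := by ring
        rw [e', ← hρdef] at h
        have h' := rn_le_of_wnorm_le hCr0 h (hF.2 _)
        have e'' : rn (-m) (ψρ : V → ℂ) = rn (-m) (𝓕 ρ) := by unfold rn; rw [hψρf, wnorm_conj]
        rwa [e'']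
      have h3 : rn (-m - 1) F ≤ C0 * rn (-m - 1) (ψ : V → ℂ) := by
        have h := hC0 F₀ hF₀n
        rw [sub_zero] at h
        have h' := rn_le_of_wnorm_le hC00 h (hF₀n.2 _)
        have e' : rn (-m - 1) F₀ = rn (-m - 1) (ψ : V → ℂ) := by unfold rn; rw [hF₀, wnorm_conj]
        rwa [e'] at h'
      have := rn_nonneg m G'
      calc ‖pairing G' ψρ‖ ≤ (wnorm m G').toReal * (wnorm (-m) (ψρ : V → ℂ)).toReal := h1
        _ = rn m G' * rn (-m) (ψρ : V → ℂ) := rfl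
        _ ≤ rn m G' * (Cr * (C0 * rn (-m - 1) (ψ : V → ℂ))) :=
            mul_le_mul_of_nonneg_left (h2.trans (mul_le_mul_of_nonneg_left h3 hCr0)) (rn_nonneg _ _)
        _ = _ := by ring
    -- assemble
    rw [hstep1, hstep2]
    calc ‖uC u ζ' (fun x => opC Y S b w (T x)) - uC u ζ' (fun x => ρ (T x))‖
        ≤ ‖uC u ζ' (fun x => opC Y S b w (T x))‖ + ‖uC u ζ' (fun x => ρ (T x))‖ := norm_sub_le _ _
      _ ≤ ‖(cT : ℂ)‖ * rn j (A : V → ℂ) * Cq * C0 * rn (-m - 1) (ψ : V → ℂ) +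
          rn m G' * Cr * C0 * rn (-m - 1) (ψ : V → ℂ) := add_le_add hA_bound hB_bound
      _ = Ctot * rn (-m - 1) (ψ : V → ℂ) := by rw [hCtot]; ring
  -- Riesz representation and uniqueness
  obtain ⟨G₁, hG₁, hG₁p⟩ := exists_inH_pairing_eq (fourierFun u ζ (T : E →L[ℝ] V)) (fourierFun_add u ζ _)
    (fourierFun_smul u ζ _) hbound
  obtain ⟨t, hGt'⟩ := hGt
  have hae : G =ᵐ[volume] G₁ := ae_eq_of_forall_pairing_schwartz hGt' hG₁ fun ψ => by rw [hG ψ, hG₁p ψ]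
  refine ⟨hGt'.1, ?_⟩
  rw [wnorm_congr_ae hae, show m + 1 = -(-m - 1) by ring]
  exact hG₁.2

end Step

/-! ### Elliptic regularity -/

section Main

variable [FiniteDimensional ℝ E] [MeasurableSpace E] [BorelSpace E]
variable [FiniteDimensional ℝ V] [MeasurableSpace V] [BorelSpace V]

/-- The radii of the nested balls of the iteration: `r 0 = R`, `r ↓`, `r n > R/2`. [folklore] -/
def iterRadius (R : ℝ) (n : ℕ) : ℝ := R / 2 + R / 2 / (n + 1)

omit [FiniteDimensional ℝ E] [MeasurableSpace E] [BorelSpace E] in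
/-- Properties of the radii. [folklore] -/
theorem iterRadius_props {R : ℝ} (hR : 0 < R) (n : ℕ) :
    iterRadius R (n + 1) < iterRadius R n ∧ R / 2 < iterRadius R n ∧ iterRadius R n ≤ R := by
  have hn : (0 : ℝ) < n + 1 := by positivity
  have hn2 : (0 : ℝ) < (n : ℝ) + 1 + 1 := by positivity
  refine ⟨?_, ?_, ?_⟩
  · simp only [iterRadius]; push_cast
    have : R / 2 / ((n : ℝ) + 1 + 1) < R / 2 / ((n : ℝ) + 1) :=
      div_lt_div_of_pos_left (by positivity) hn (by linarith)
    linarith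
  · simp only [iterRadius]; have : 0 < R / 2 / ((n : ℝ) + 1) := by positivity
    linarith
  · simp only [iterRadius]
    have : R / 2 / ((n : ℝ) + 1) ≤ R / 2 := div_le_self (by positivity) (by linarith)
    linarith

/-- **Smoothness near a point.** For an elliptic `(X, S, a)` on `Ω`, if `L u = f` with `f` smooth
on the open `U ⊆ Ω` then `u` is a smooth function near every point of `U` (the iteration of
`elliptic_bootstrap_step` along nested balls, started by `exists_fourierSide_unif` and concluded by
`Rep.isSmoothOn`). [folklore] -/
theorem exists_isSmoothOn_nhds_of_isEllipticOn [Nontrivial V] (μ : Measure E) [μ.IsAddHaarMeasure] (T : E ≃L[ℝ] V)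
    (hX : ∀ i, ContDiff ℝ ∞ (X i)) (ha : ∀ w, ContDiff ℝ ∞ (a w)) {Ω : Opens E}
    (hell : IsEllipticOn X S a k (Ω : Set E))
    {u : 𝓓'(Ω, ℝ)} {U : Set E} (hU : IsOpen U) (hUΩ : U ⊆ (Ω : Set E)) {f : E → ℝ} (hfU : ContDiffOn ℝ ∞ f U)
    (hfu : ∀ φ ψ : 𝓓(Ω, ℝ), tsupport (φ : E → ℝ) ⊆ U → (ψ : E → ℝ) = smoothDiffOpTranspose X S a φ →
      u ψ = ∫ x, f x * φ x ∂μ)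
    {x : E} (hx : x ∈ U) :
    ∃ W : Set E, IsOpen W ∧ x ∈ W ∧ W ⊆ U ∧ IsSmoothOn u μ W := by
  have hS : ∀ w ∈ S, w.length ≤ k := hell.1
  obtain ⟨cT, hcT, hT⟩ := exists_integral_comp_eq μ T
  -- a closed ball around `T x` whose preimage lies in `U`
  have hUx : (T.symm : V → E) ⁻¹' U ∈ 𝓝 (T x) :=
    T.symm.continuous.continuousAt.preimage_mem_nhds (by simpa using hU.mem_nhds hx)
  obtain ⟨R, hR, hRU⟩ := Metric.nhds_basis_closedBall.mem_iff.1 hUx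
  have hpre : ∀ {s : Set V}, s ⊆ closedBall (T x) R → (T : E → V) ⁻¹' s ⊆ U := fun hs z hz => by
    have := hRU (hs hz); simpa using this
  -- the big compact and the uniform finite order
  set K : Set E := (T : E → V) ⁻¹' closedBall (T x) R with hK
  have hKc : IsCompact K := by
    rw [hK, ← T.image_symm_eq_preimage]; exact (isCompact_closedBall _ _).image T.symm.continuous
  have hKU : K ⊆ U := hpre Subset.rfl
  obtain ⟨M, hM⟩ := exists_fourierSide_unif u ⟨K, hKc⟩ (hKU.trans hUΩ) (T : E →L[ℝ] V)
  choose Gf hGin hGpair using hM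
  -- representation of the identity by every `Gf ζ`
  have hRep : ∀ (ζ : 𝓓(Ω, ℝ)) (hζ : tsupport (ζ : E → ℝ) ⊆ K), Rep u ζ (T : E →L[ℝ] V) (Gf ζ hζ) id := fun ζ hζ =>
    ⟨⟨-M, hGin ζ hζ⟩, fun h hh => hh, fun _ _ _ _ => rfl, fun _ _ _ => rfl, fun ψ => by
      rw [hGpair ζ hζ ψ, fourierFun_eq_uC]; rfl⟩
  -- the nested balls
  set r : ℕ → ℝ := iterRadius R with hr
  have hrK : ∀ n, (T : E → V) ⁻¹' ball (T x) (r n) ⊆ K := fun n =>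
    preimage_mono (ball_subset_closedBall.trans (closedBall_subset_closedBall (iterRadius_props hR n).2.2))
  -- the induction over the levels
  have hlevel : ∀ (n : ℕ) (ζ : 𝓓(Ω, ℝ)) (hζ : tsupport (ζ : E → ℝ) ⊆ (T : E → V) ⁻¹' ball (T x) (r n)),
      InH (-M + n) (Gf ζ (hζ.trans (hrK n))) := by
    intro n
    induction n with
    | zero =>
      intro ζ hζ
      simpa using hGin ζ (hζ.trans (hrK 0))
    | succ n ih =>
      intro ζ hζ
      obtain ⟨hr1, -, hrR⟩ := iterRadius_props hR n
      set ρ₁ : ℝ := (2 * r (n + 1) + r n) / 3 with hρ₁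
      set ρ₂ : ℝ := (r (n + 1) + 2 * r n) / 3 with hρ₂
      have h01 : r (n + 1) < ρ₁ := by rw [hρ₁]; linarith
      have h12 : ρ₁ < ρ₂ := by rw [hρ₁, hρ₂]; linarith
      have h2n : ρ₂ < r n := by rw [hρ₂]; linarith
      have hρ₂R : ρ₂ ≤ R := by linarith
      -- the cutoff `χ` on `V`
      obtain ⟨χ, hχs, hχc, hχsupp, hχ1⟩ := exists_bump (isCompact_closedBall (T x) ρ₁) isOpen_ball
        (closedBall_subset_ball h12)
      -- the cutoff `ζ'` on `E`
      have hK2 : IsCompact ((T : E → V) ⁻¹' closedBall (T x) ρ₂) := by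
        rw [← T.image_symm_eq_preimage]; exact (isCompact_closedBall _ _).image T.symm.continuous
      obtain ⟨η, hηs, hηc, hηsupp, hη1⟩ := exists_bump hK2 (isOpen_ball.preimage T.continuous)
        (preimage_mono (closedBall_subset_ball h2n) : (T : E → V) ⁻¹' closedBall (T x) ρ₂ ⊆ (T : E → V) ⁻¹' ball (T x) (r n))
      have hηΩ : tsupport η ⊆ (Ω : Set E) := (hηsupp.trans (hrK n)).trans (hKU.trans hUΩ)
      let ζ' : 𝓓(Ω, ℝ) := ⟨η, hηs, hηc, hηΩ⟩
      have hζ' : tsupport (ζ' : E → ℝ) ⊆ (T : E → V) ⁻¹' ball (T x) (r n) := hηsupp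
      have ih' := ih ζ' hζ'
      -- the hypotheses of the step
      have hχU : (T : E → V) ⁻¹' tsupport χ ⊆ U :=
        hpre (hχsupp.trans (ball_subset_closedBall.trans (closedBall_subset_closedBall hρ₂R)))
      have hell' : ∀ y ∈ tsupport χ, ∀ ξ : V, ξ ≠ 0 →
          twSymb (fun i => push T (X i)) S (pushCoef T a) k y ξ ≠ 0 := by
        intro y hy ξ hξ
        have hyU : T.symm y ∈ U := by
          have : T (T.symm y) ∈ tsupport χ := by simpa using hy
          exact hχU this
        have h := twSymb_ne_zero_of_isEllipticOn hell T (hUΩ hyU) hξ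
        simpa using h
      have hζχ : ∀ z ∈ tsupport (ζ : E → ℝ), χ (T z) = 1 := fun z hz =>
        hχ1 _ (ball_subset_closedBall (ball_subset_ball h01.le (hζ hz)))
      have hζ'χ : ∀ z ∈ (T : E → V) ⁻¹' tsupport χ, ζ' z = 1 := fun z hz =>
        hη1 z (show T z ∈ closedBall (T x) ρ₂ from ball_subset_closedBall (hχsupp hz))
      have hζζ' : ∀ z ∈ tsupport (ζ : E → ℝ), ζ' z = 1 := fun z hz =>
        hη1 z (show T z ∈ closedBall (T x) ρ₂ from
          ball_subset_closedBall (ball_subset_ball (by linarith) (hζ hz)))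
      have hstep := elliptic_bootstrap_step μ T hT hX ha hS hU hfU hfu hχs hχc hχU (hχU.trans hUΩ) hell' hζχ hζ'χ hζζ'
        (hGpair ζ (hζ.trans (hrK (n + 1)))) ⟨-M, hGin ζ _⟩ (hRep ζ' (hζ'.trans (hrK n))) ih'
      have e : -M + ((n + 1 : ℕ) : ℝ) = -M + n + 1 := by push_cast; ring
      rw [e]; exact hstep
  -- the final cutoff, `= 1` on `T⁻¹ ball (T x) (R/4)`
  have hK4 : IsCompact ((T : E → V) ⁻¹' closedBall (T x) (R / 4)) := by
    rw [← T.image_symm_eq_preimage]; exact (isCompact_closedBall _ _).image T.symm.continuous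
  have h42 : (T : E → V) ⁻¹' closedBall (T x) (R / 4) ⊆ (T : E → V) ⁻¹' ball (T x) (R / 2) :=
    preimage_mono (closedBall_subset_ball (by linarith))
  obtain ⟨η₁, hη₁s, hη₁c, hη₁supp, hη₁1⟩ := exists_bump hK4 (isOpen_ball.preimage T.continuous) h42
  have hballr : ∀ n, (T : E → V) ⁻¹' ball (T x) (R / 2) ⊆ (T : E → V) ⁻¹' ball (T x) (r n) := fun n =>
    preimage_mono (ball_subset_ball (iterRadius_props hR n).2.1.le)
  have hη₁Ω : tsupport η₁ ⊆ (Ω : Set E) := ((hη₁supp.trans (hballr 0)).trans (hrK 0)).trans (hKU.trans hUΩ)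
  let ζ₁ : 𝓓(Ω, ℝ) := ⟨η₁, hη₁s, hη₁c, hη₁Ω⟩
  have hζ₁K : tsupport (ζ₁ : E → ℝ) ⊆ K := (hη₁supp.trans (hballr 0)).trans (hrK 0)
  have hNice : Nice (Gf ζ₁ hζ₁K) := by
    refine ⟨(hGin ζ₁ hζ₁K).1, fun t => ?_⟩
    obtain ⟨n, hn⟩ := exists_nat_gt (t + M)
    have h := hlevel n ζ₁ (hη₁supp.trans (hballr n))
    exact (h.mono (by linarith)).2
  -- conclusion
  have hT' : ∀ g : V → ℂ, ∫ z, g ((T : E →L[ℝ] V) z) ∂μ = (cT : ℂ) * ∫ y, g y := hT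
  refine ⟨(T : E → V) ⁻¹' ball (T x) (R / 4), isOpen_ball.preimage T.continuous, by simp [hR],
    hpre (ball_subset_closedBall.trans (closedBall_subset_closedBall (by linarith))), ?_⟩
  exact Rep.isSmoothOn (hRep ζ₁ hζ₁K) hNice (Complex.ofReal_ne_zero.2 hcT) hT'
    (fun φ => (exists_avatar_real T φ.contDiff φ.hasCompactSupport).imp fun q hq => hq.1)
    (fun z hz => hη₁1 z (ball_subset_closedBall hz))

omit [FiniteDimensional ℝ V] [MeasurableSpace V] [BorelSpace V] in
/-- **Elliptic regularity (Folland 1995, Cor. (6.34)).** A linear differential operator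
`∑_{w ∈ S} a_w X_w` with smooth vector fields and coefficients on a finite-dimensional real space
of positive dimension, elliptic of order `k` at every point of the open set `Ω`, is hypoelliptic
in `Ω`. [cite: Folland2020, Cor. (6.34)] -/
theorem isHypoellipticOn_of_isEllipticOn [Nontrivial E] (μ : Measure E) [μ.IsAddHaarMeasure]
    (hX : ∀ i, ContDiff ℝ ∞ (X i)) (ha : ∀ w ∈ S, ContDiff ℝ ∞ (a w)) {Ω : Opens E}
    (hell : IsEllipticOn X S a k (Ω : Set E)) :
    IsHypoellipticOn Ω (smoothDiffOpTranspose X S a) μ := by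
  classical
  -- normalise the coefficients outside `S`
  set a' : List ι → E → ℝ := fun w => if w ∈ S then a w else 0 with ha'def
  have ha' : ∀ w, ContDiff ℝ ∞ (a' w) := fun w => by
    by_cases hw : w ∈ S
    · simpa [ha'def, hw] using ha w hw
    · simp only [ha'def, hw, if_false]; exact contDiff_const
  have hop : smoothDiffOpTranspose X S a' = smoothDiffOpTranspose X S a := by
    ext g y
    simp only [smoothDiffOpTranspose]
    exact Finset.sum_congr rfl fun w hw => by simp [ha'def, hw]
  have hell' : IsEllipticOn X S a' k (Ω : Set E) := by
    refine ⟨hell.1, fun y hy ξ hξ => ?_⟩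
    have e : principalSymbol X S a' k y ξ = principalSymbol X S a k y ξ := by
      simp only [principalSymbol]
      exact Finset.sum_congr rfl fun w hw => by simp [ha'def, (Finset.mem_filter.1 hw).1]
    rw [e]; exact hell.2 y hy ξ hξ
  rw [← hop]
  intro u U hU hUΩ hPu
  obtain ⟨f, hfU, hfu⟩ := hPu
  set T : E ≃L[ℝ] EuclideanSpace ℝ (Fin (Module.finrank ℝ E)) := toEuclidean with hTdef
  haveI : Nontrivial (EuclideanSpace ℝ (Fin (Module.finrank ℝ E))) := T.injective.nontrivial
  refine IsSmoothOn.of_locally hUΩ fun x hx => ?_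
  exact exists_isSmoothOn_nhds_of_isEllipticOn μ T hX ha' hell' hU hUΩ hfU hfu hx

end Main

end Literature.Analysis.Hypoelliptic
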